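import Literature.NumberTheory.DiophantineGeometry.FermatFunctionFieldBelyiMap
import HarnessLib

/-!
# Radical layers `F' = F(g)`, `g^q = h`: ramification and transfer of signatures

Topic: `Literature/NumberTheory/DiophantineGeometry`. Theorem-only file (no definition, no named
fact), a tool for constructing EXPLICIT coverings of `ℙ¹` with prescribed signature in the tree's
function-field language (towards the covering input of Darmon–Granville's Theorem 2,
`darmonGranville1995_thm_2_of_minimal_belyiMaps_of_faltings`; the signature `(n, n, n)` is
`FermatFunctionFieldBelyiMap`). A covering is built in two steps: a function `s` on a base function
field `F/K` whose orders at zeros, at zeros of `s - 1`, at poles and over the other closed points of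
the `s`-line are known ("the seed"), and a radical ("Kummer") layer `F' = F(g)` with `g^q = h`,
`h ∈ F^×`, `q ≠ 0` in `K`. This file computes the ramification of the layer at a place `Q` of `F'`
above `P` (Stichtenoth Prop. 3.7.3, the two extreme cases of `e(Q|P) = q / gcd(q, v_P(h))`):

* `q ∣ v_P(h)` ⇒ `e(Q|P) = 1` (`PlaceOver.ord_algebraMap_uniformizer_eq_one_of_pow_eq_of_dvd`, the
  integer version of the tree's `…_of_pow_eq` of `FunctionFieldRadicalBaseChange`, poles allowed);
* `gcd(v_P(h), q) = 1` ⇒ `e(Q|P) = q = [F' : F]` and `deg Q = deg P`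
  (`PlaceOver.ord_algebraMap_uniformizer_eq_of_pow_eq_of_isCoprime`,
  `PlaceOver.degree_eq_of_pow_eq_of_isCoprime`; in particular a rational `P` with `v_P(h)` prime to
  `q` has a rational place above it, `exists_isRational_of_pow_eq_of_isCoprime`, which makes `K` the
  full constant field of `F'`);

and transfers the seed's data upstairs through `v_Q = e(Q|P) · v_P`
(`PlaceOver.ord_algebraMap_eq_mul`): zeros (`ord_algebraMap_eq_of_forall_ord_pos_of_dvd`,
`…_of_isCoprime`) and poles (`ord_algebraMap_eq_of_forall_ord_neg_of_dvd`, `…_of_isCoprime`) of any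
`s ∈ F`; zeros of `s - 1` and the values `π₀(s)` at the other closed points are zeros of the elements
`s - 1`, `π₀(s)` of `F`, so the same two lemmas serve.

## References

* H. Stichtenoth, *Algebraic Function Fields and Codes*, GTM 254, 2009: Prop. 3.7.3 (Kummer
  extensions), Thm. 3.1.11. [Stichtenoth2009]
* H. Darmon, A. Granville, *On the equations `z^m = F(x, y)` and `A x^p + B y^q = C z^r`*, Bull. London
  Math. Soc. 27 (1995) 513–543: Prop. 3.1 (p. 525). [DarmonGranville1995]
-/

noncomputable section

open scoped Classical Polynomial IntermediateField

namespace Literature.NumberTheory.DiophantineGeometry.AlgFunctionField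

open Polynomial

universe u v

namespace PlaceOver

variable {K : Type u} {F : Type v} {F' : Type v} [Field K] [Field F] [Algebra K F]
variable [Field F'] [Algebra F F'] [Algebra K F'] [IsScalarTower K F F']
variable [IsAlgFunctionField K F] [IsAlgFunctionField K F'] [FiniteDimensional F F']
  [Algebra.IsSeparable F F']

/-! ### A. `q ∣ v_P(h)`: the layer is unramified at `P` -/

/-- **Kummer layer, unramified case** (Stichtenoth Prop. 3.7.3 (b) with `gcd(q, v_P(h)) = q`): if
`F' = F(g)` with `g^q = h`, `q ≠ 0` in `K`, and `q ∣ v_P(h)` (poles of `h` allowed), then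
`e(Q|P) = 1` for every place `Q` of `F'` above `P`. Rescale to `y = g π_P^{-k}`, `y^q = h π_P^{-qk}`
a unit at `P`, and apply the tree's `…_of_pow_eq_of_ord_eq_zero`. [cite: Stichtenoth2009, Prop. 3.7.3(b)] -/
theorem ord_algebraMap_uniformizer_eq_one_of_pow_eq_of_dvd (P : PlaceOver K F)
    {q : ℕ} (hq : 0 < q) (hqK : (q : K) ≠ 0) {h : F} (hh0 : h ≠ 0) (hk : (q : ℤ) ∣ P.ord h)
    {g : F'} (hg : g ^ q = algebraMap F F' h) (hgen : F⟮g⟯ = ⊤)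
    (Q : PlaceOver K F') (hQ : Q.restrict (K := K) (F := F) = P) :
    Q.ord (algebraMap F F' (P.uniformizer : F)) = 1 := by
  obtain ⟨k, hk⟩ := hk
  set π : F := (P.uniformizer : F) with hπ
  have hπ0 : π ≠ 0 := P.coe_uniformizer_ne_zero
  have hπ1 : P.ord π = 1 := P.ord_uniformizer_eq_one
  set u : F := h * π ^ (-((q : ℤ) * k)) with hu
  have hu0 : u ≠ 0 := mul_ne_zero hh0 (zpow_ne_zero _ hπ0)
  have hordu : P.ord u = 0 := by
    rw [hu, P.ord_mul_eq hh0 (zpow_ne_zero _ hπ0), P.ord_zpow hπ0, hk, hπ1]; ring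
  set y : F' := algebraMap F F' (π ^ (-k)) * g with hy
  have hyp : y ^ q = algebraMap F F' u := by
    rw [hy, mul_pow, hg, hu, map_mul, ← map_pow, ← zpow_natCast (π ^ (-k)) q, ← zpow_mul, mul_comm]
    congr 2
    ring
  have hgen' : F⟮y⟯ = ⊤ := adjoin_algebraMap_mul_eq_top hgen (zpow_ne_zero _ hπ0)
  exact P.ord_algebraMap_uniformizer_eq_one_of_pow_eq_of_ord_eq_zero hq hqK hu0 hordu hyp hgen' Q hQ

/-! ### B. `gcd(v_P(h), q) = 1`: the layer is totally ramified at `P` -/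

omit [Algebra.IsSeparable F F'] in
/-- **Kummer layer, totally ramified case** (Stichtenoth Prop. 3.7.3 (b) with `gcd(q, v_P(h)) = 1`):
if `F' = F(g)` with `g^q = h` and `v_P(h)` is prime to `q`, then `e(Q|P) = q = [F' : F]` for every
place `Q` of `F'` above `P`: `q v_Q(g) = e(Q|P) v_P(h)` gives `q ∣ e(Q|P)`, and
`e(Q|P) ≤ [F' : F] ≤ q`. [cite: Stichtenoth2009, Prop. 3.7.3(b)] -/
theorem ord_algebraMap_uniformizer_eq_of_pow_eq_of_isCoprime
    (P : PlaceOver K F) {q : ℕ} (hq : 0 < q) {h : F} (hh0 : h ≠ 0)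
    (hcop : IsCoprime (P.ord h) (q : ℤ)) {g : F'} (hg : g ^ q = algebraMap F F' h)
    (hgen : F⟮g⟯ = ⊤) (Q : PlaceOver K F') (hQ : Q.restrict (K := K) (F := F) = P) :
    Q.ord (algebraMap F F' (P.uniformizer : F)) = q ∧ Module.finrank F F' = q := by
  have hg0 : g ≠ 0 := by
    rintro rfl
    rw [zero_pow hq.ne'] at hg
    exact hh0 ((_root_.map_eq_zero _).1 hg.symm)
  have hmul := Q.ord_algebraMap_eq_mul (K := K) (F := F) h
  rw [hQ, ← hg, Q.ord_pow hg0] at hmul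
  have he1 := Q.one_le_ord_algebraMap_uniformizer (K := K) (F := F)
  rw [hQ] at he1
  have hele := PlaceOver.ord_algebraMap_uniformizer_le_finrank (K := K) (F := F) (P' := Q)
    (P := P) hQ
  have hfin : Module.finrank F F' ≤ q := finrank_le_of_pow_eq_of_adjoin_eq_top hq hg hgen
  have hfin' : (Module.finrank F F' : ℤ) ≤ q := by exact_mod_cast hfin
  have hdvd : (q : ℤ) ∣ Q.ord (algebraMap F F' (P.uniformizer : F)) := by
    have h1 : (q : ℤ) ∣ Q.ord (algebraMap F F' (P.uniformizer : F)) * P.ord h :=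
      ⟨Q.ord g, by rw [← hmul]⟩
    exact hcop.symm.dvd_of_dvd_mul_right h1
  obtain ⟨m, hm⟩ := hdvd
  have hq' : (0 : ℤ) < q := by exact_mod_cast hq
  have hm1 : 1 ≤ m := by
    by_contra hlt
    have : (q : ℤ) * m ≤ 0 := mul_nonpos_of_nonneg_of_nonpos hq'.le (by omega)
    omega
  have heq : Q.ord (algebraMap F F' (P.uniformizer : F)) = q := by nlinarith
  refine ⟨heq, ?_⟩
  rw [heq] at hele
  have : q ≤ Module.finrank F F' := by exact_mod_cast hele
  omega

omit [Algebra.IsSeparable F F'] in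
/-- In the totally ramified case `deg Q = deg P` (and `Q` is the only place above `P`).
[cite: Stichtenoth2009, Prop. 3.7.3(b), Thm. 3.1.11] -/
theorem degree_eq_of_pow_eq_of_isCoprime
    (P : PlaceOver K F) {q : ℕ} (hq : 0 < q) {h : F} (hh0 : h ≠ 0)
    (hcop : IsCoprime (P.ord h) (q : ℤ)) {g : F'} (hg : g ^ q = algebraMap F F' h)
    (hgen : F⟮g⟯ = ⊤) (Q : PlaceOver K F') (hQ : Q.restrict (K := K) (F := F) = P) :
    Q.degree = P.degree := by
  obtain ⟨he, hfr⟩ := P.ord_algebraMap_uniformizer_eq_of_pow_eq_of_isCoprime hq hh0 hcop hg hgen Q hQ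
  exact (eq_of_ord_algebraMap_uniformizer_eq_finrank hQ (by rw [he, hfr])).2

omit [Algebra.IsSeparable F F'] in
/-- **A rational place above a rational place at which the layer is totally ramified**: if `P` is
rational and `v_P(h)` is prime to `q`, some (the) place of `F' = F(h^{1/q})` above `P` is rational; in
particular `K` is then the full constant field of `F'` (`isIntegrallyClosedIn_of_isRational`).
[cite: Stichtenoth2009, Prop. 3.7.3(b)] -/
theorem exists_isRational_of_pow_eq_of_isCoprime
    (P : PlaceOver K F) (hP : P.IsRational) {q : ℕ} (hq : 0 < q) {h : F} (hh0 : h ≠ 0)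
    (hcop : IsCoprime (P.ord h) (q : ℤ)) {g : F'} (hg : g ^ q = algebraMap F F' h)
    (hgen : F⟮g⟯ = ⊤) : ∃ Q : PlaceOver K F', Q.IsRational := by
  obtain ⟨Q, hQ⟩ := P.exists_restrict_eq' (F' := F')
  refine ⟨Q, ?_⟩
  have hdeg := P.degree_eq_of_pow_eq_of_isCoprime hq hh0 hcop hg hgen Q hQ
  unfold IsRational at hP ⊢
  rw [hdeg, hP]

/-! ### C. Transfer of orders from the seed `s ∈ F` to `F'` -/

/-- **Zeros, unramified layer.** If every zero `P` of `s ∈ F` has `v_P(s) = p₀` and `q ∣ v_P(h)`, then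
every zero `Q` of `s` in `F' = F(h^{1/q})` has `v_Q(s) = p₀`. [cite: Stichtenoth2009, Prop. 3.7.3(b)] -/
theorem ord_algebraMap_eq_of_forall_ord_pos_of_dvd {q : ℕ} (hq : 0 < q) (hqK : (q : K) ≠ 0)
    {h : F} (hh0 : h ≠ 0) {g : F'} (hg : g ^ q = algebraMap F F' h) (hgen : F⟮g⟯ = ⊤)
    {s : F} {p₀ : ℤ} (hs : ∀ P : PlaceOver K F, 0 < P.ord s → P.ord s = p₀ ∧ (q : ℤ) ∣ P.ord h)
    (Q : PlaceOver K F') (hQ : 0 < Q.ord (algebraMap F F' s)) : Q.ord (algebraMap F F' s) = p₀ := by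
  have hmul := Q.ord_algebraMap_eq_mul (K := K) (F := F) s
  have he1 := Q.one_le_ord_algebraMap_uniformizer (K := K) (F := F)
  have hPs : 0 < (Q.restrict (K := K) (F := F)).ord s := by
    by_contra hle
    have : Q.ord (algebraMap F F' ((Q.restrict (K := K) (F := F)).uniformizer : F)) *
        (Q.restrict (K := K) (F := F)).ord s ≤ 0 :=
      mul_nonpos_of_nonneg_of_nonpos (by omega) (not_lt.1 hle)
    omega
  obtain ⟨hp₀, hdvd⟩ := hs _ hPs
  have he := (Q.restrict (K := K) (F := F)).ord_algebraMap_uniformizer_eq_one_of_pow_eq_of_dvd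
    hq hqK hh0 hdvd hg hgen Q rfl
  rw [hmul, he, one_mul, hp₀]

omit [Algebra.IsSeparable F F'] in
/-- **Zeros, totally ramified layer.** If every zero `P` of `s ∈ F` has `v_P(s) = p₀` and `v_P(h)`
prime to `q`, then every zero `Q` of `s` in `F' = F(h^{1/q})` has `v_Q(s) = q p₀`.
[cite: Stichtenoth2009, Prop. 3.7.3(b)] -/
theorem ord_algebraMap_eq_of_forall_ord_pos_of_isCoprime {q : ℕ}
    (hq : 0 < q) {h : F} (hh0 : h ≠ 0) {g : F'} (hg : g ^ q = algebraMap F F' h) (hgen : F⟮g⟯ = ⊤)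
    {s : F} {p₀ : ℤ}
    (hs : ∀ P : PlaceOver K F, 0 < P.ord s → P.ord s = p₀ ∧ IsCoprime (P.ord h) (q : ℤ))
    (Q : PlaceOver K F') (hQ : 0 < Q.ord (algebraMap F F' s)) :
    Q.ord (algebraMap F F' s) = q * p₀ := by
  have hmul := Q.ord_algebraMap_eq_mul (K := K) (F := F) s
  have he1 := Q.one_le_ord_algebraMap_uniformizer (K := K) (F := F)
  have hPs : 0 < (Q.restrict (K := K) (F := F)).ord s := by
    by_contra hle
    have : Q.ord (algebraMap F F' ((Q.restrict (K := K) (F := F)).uniformizer : F)) *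
        (Q.restrict (K := K) (F := F)).ord s ≤ 0 :=
      mul_nonpos_of_nonneg_of_nonpos (by omega) (not_lt.1 hle)
    omega
  obtain ⟨hp₀, hcop⟩ := hs _ hPs
  obtain ⟨he, -⟩ := (Q.restrict (K := K) (F := F)).ord_algebraMap_uniformizer_eq_of_pow_eq_of_isCoprime
    hq hh0 hcop hg hgen Q rfl
  rw [hmul, he, hp₀]

/-- **Poles, unramified layer.** If every pole `P` of `s ∈ F` has `v_P(s) = -p₀` and `q ∣ v_P(h)`,
then every pole `Q` of `s` in `F'` has `v_Q(s) = -p₀`. [cite: Stichtenoth2009, Prop. 3.7.3(b)] -/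
theorem ord_algebraMap_eq_of_forall_ord_neg_of_dvd {q : ℕ} (hq : 0 < q) (hqK : (q : K) ≠ 0)
    {h : F} (hh0 : h ≠ 0) {g : F'} (hg : g ^ q = algebraMap F F' h) (hgen : F⟮g⟯ = ⊤)
    {s : F} {p₀ : ℤ} (hs : ∀ P : PlaceOver K F, P.ord s < 0 → P.ord s = -p₀ ∧ (q : ℤ) ∣ P.ord h)
    (Q : PlaceOver K F') (hQ : Q.ord (algebraMap F F' s) < 0) : Q.ord (algebraMap F F' s) = -p₀ := by
  have hmul := Q.ord_algebraMap_eq_mul (K := K) (F := F) s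
  have he1 := Q.one_le_ord_algebraMap_uniformizer (K := K) (F := F)
  have hPs : (Q.restrict (K := K) (F := F)).ord s < 0 := by
    by_contra hle
    have : 0 ≤ Q.ord (algebraMap F F' ((Q.restrict (K := K) (F := F)).uniformizer : F)) *
        (Q.restrict (K := K) (F := F)).ord s :=
      mul_nonneg (by omega) (not_lt.1 hle)
    omega
  obtain ⟨hp₀, hdvd⟩ := hs _ hPs
  have he := (Q.restrict (K := K) (F := F)).ord_algebraMap_uniformizer_eq_one_of_pow_eq_of_dvd
    hq hqK hh0 hdvd hg hgen Q rfl
  rw [hmul, he, one_mul, hp₀]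

omit [Algebra.IsSeparable F F'] in
/-- **Poles, totally ramified layer.** If every pole `P` of `s ∈ F` has `v_P(s) = -p₀` and `v_P(h)`
prime to `q`, then every pole `Q` of `s` in `F'` has `v_Q(s) = -(q p₀)`.
[cite: Stichtenoth2009, Prop. 3.7.3(b)] -/
theorem ord_algebraMap_eq_of_forall_ord_neg_of_isCoprime {q : ℕ}
    (hq : 0 < q) {h : F} (hh0 : h ≠ 0) {g : F'} (hg : g ^ q = algebraMap F F' h) (hgen : F⟮g⟯ = ⊤)
    {s : F} {p₀ : ℤ}
    (hs : ∀ P : PlaceOver K F, P.ord s < 0 → P.ord s = -p₀ ∧ IsCoprime (P.ord h) (q : ℤ))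
    (Q : PlaceOver K F') (hQ : Q.ord (algebraMap F F' s) < 0) :
    Q.ord (algebraMap F F' s) = -(q * p₀) := by
  have hmul := Q.ord_algebraMap_eq_mul (K := K) (F := F) s
  have he1 := Q.one_le_ord_algebraMap_uniformizer (K := K) (F := F)
  have hPs : (Q.restrict (K := K) (F := F)).ord s < 0 := by
    by_contra hle
    have : 0 ≤ Q.ord (algebraMap F F' ((Q.restrict (K := K) (F := F)).uniformizer : F)) *
        (Q.restrict (K := K) (F := F)).ord s :=
      mul_nonneg (by omega) (not_lt.1 hle)
    omega
  obtain ⟨hp₀, hcop⟩ := hs _ hPs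
  obtain ⟨he, -⟩ := (Q.restrict (K := K) (F := F)).ord_algebraMap_uniformizer_eq_of_pow_eq_of_isCoprime
    hq hh0 hcop hg hgen Q rfl
  rw [hmul, he, hp₀, mul_neg]

end PlaceOver

end Literature.NumberTheory.DiophantineGeometry.AlgFunctionField
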